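import Summits.Ventures.Crystal3D.Theorems.StickyWulffConstantCoaxialWallLawWallLedgerFDefs
import HarnessLib

/-!
# Definitions: the UNIFORM co-axial two-slab adhesion law (debt F-U of lane F, the sibling lane T imports)

HONEST FRAMING. Venture `Summits/Ventures/Crystal3D` (cell `crystal3d-full`), crux `CoaxialWallLaw`
(stmt-Ventures-19481, `route-Ventures-StickyWulffConstant`), REGISTERED line `WallLedgerF` (planner cf-p1).  DEFINITIONS
ONLY; nothing is claimed; F-C1 not moved.  cf-p1 DECISIONS (xlv⁗) (2026-08-28T22:21Z, quantifier order R1) and (li)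
(23:08:50Z, «F-U text of record»): lane T (`TextureLiminf`, line TexShadow) consumes the co-axial wall law UNIFORMLY —
constants `(C, R₀)` chosen BEFORE the pair `(A₁, t₁, A₂, t₂)` and for every `R₀ ≥ R` — whereas the registered stub
`CoaxialTwoSlabAdhesion` (`…WallLedgerFDefs`) and every level of the landed chain (`TwoSlabLedgerAt`,
`CoaxialTwoSlabAdhesionOn`) quantify `∃ C R₀` AFTER the pair.  This file types the uniform sibling, VERBATIM the text
`hFU` of the T-side dispatcher (`…TexShadowFccDispatch`, wulff-p2 g16; = `TexShadow.CoaxialUnifAt`, so that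
`TexShadow.CoaxialUnifFrom R` and `CoaxialTwoSlabAdhesionUnifFrom R` unfold to each other):

* `CoaxialTwoSlabAdhesionUnifAt C R₀` — for EVERY co-axial pair of distinct fcc lattices: shared-frame data and the
  clamped-cylinder cell inequality of `CoaxialTwoSlabAdhesion` at the constants `(C, R₀)`, charge `½ √(1 − ⟪L e₃, e₃⟫²)`;
* `CoaxialTwoSlabAdhesionUnifFrom R := ∀ R₀, R ≤ R₀ → ∃ C, CoaxialTwoSlabAdhesionUnifAt C R₀` — debt **F-U**; lane T's
  stub is `∃ R, CoaxialTwoSlabAdhesionUnifFrom R`;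
* `coaxialTwoSlabAdhesion_of_unifAt` — the uniform law at any `R₀ ≥ 1` implies the registered per-pair stub (sanity; the
  converse is the content of F-U).
WHAT THIS IS NOT: F-U is NOT proved here (status: the chain's constants must be audited / re-threaded pair-free —
`AffineSampleDeficit`'s constant is `60√2π` uniformly (`sampleDeficit_offset_window`), the row rungs and the census-free
ledgers are to be checked); F-C1 not moved.
-/

noncomputable section

namespace Summit.Ventures.Crystal3D.Theorems

open Summit.Ventures.Crystal3D
open Summit.Ventures.Crystal3D.Cruxes.CoaxialWallLaw.WallLedgerF (CoaxialTwoSlabAdhesion)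
open Literature.MathematicalPhysics.StatisticalMechanics (fccStacking barlowStacking IsHaggSeq contactDeficiency)
open scoped InnerProductSpace

/-- **The uniform co-axial two-slab adhesion law at constants `(C, R₀)`** (the T-side text `hFU` verbatim): for every
co-axial pair of distinct moved fcc lattices there are shared-frame data such that the clamped-cylinder cell inequality
of `CoaxialTwoSlabAdhesion` holds with THESE `C`, `R₀`. -/
def CoaxialTwoSlabAdhesionUnifAt (C R₀ : ℝ) : Prop :=
  ∀ (P₁ : EuclideanSpace ℝ (Fin 3) ≃ₗᵢ[ℝ] EuclideanSpace ℝ (Fin 3)) (t₁ : EuclideanSpace ℝ (Fin 3))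
    (P₂ : EuclideanSpace ℝ (Fin 3) ≃ₗᵢ[ℝ] EuclideanSpace ℝ (Fin 3)) (t₂ : EuclideanSpace ℝ (Fin 3)),
    (∃ (L : EuclideanSpace ℝ (Fin 3) ≃ₗᵢ[ℝ] EuclideanSpace ℝ (Fin 3)) (r₁ r₂ : EuclideanSpace ℝ (Fin 3)) (σ σ' : ℤ → ℤ),
        IsHaggSeq σ ∧ IsHaggSeq σ' ∧
        (fun p => P₁ p + t₁) '' fccStacking 1 (Real.sqrt (2 / 3)) ⊆
          (fun p => L p + r₁) '' barlowStacking 1 (Real.sqrt (2 / 3)) σ ∧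
        (fun p => P₂ p + t₂) '' fccStacking 1 (Real.sqrt (2 / 3)) ⊆
          (fun p => L p + r₂) '' barlowStacking 1 (Real.sqrt (2 / 3)) σ') →
    (fun p => P₁ p + t₁) '' fccStacking 1 (Real.sqrt (2 / 3)) ≠
      (fun p => P₂ p + t₂) '' fccStacking 1 (Real.sqrt (2 / 3)) →
    ∃ (L : EuclideanSpace ℝ (Fin 3) ≃ₗᵢ[ℝ] EuclideanSpace ℝ (Fin 3)) (r₁ r₂ : EuclideanSpace ℝ (Fin 3)) (σ σ' : ℤ → ℤ),
      IsHaggSeq σ ∧ IsHaggSeq σ' ∧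
      (fun p => P₁ p + t₁) '' fccStacking 1 (Real.sqrt (2 / 3)) ⊆
        (fun p => L p + r₁) '' barlowStacking 1 (Real.sqrt (2 / 3)) σ ∧
      (fun p => P₂ p + t₂) '' fccStacking 1 (Real.sqrt (2 / 3)) ⊆
        (fun p => L p + r₂) '' barlowStacking 1 (Real.sqrt (2 / 3)) σ' ∧
      ∀ h : ℝ, 0 ≤ h → ∀ ρ : ℝ, R₀ ≤ ρ → ∀ X Q₁ Q₂ : Finset (EuclideanSpace ℝ (Fin 3)),
        (∀ p ∈ X, ∀ q ∈ X, p ≠ q → 1 ≤ dist p q) → Q₁ ⊆ X → Q₂ ⊆ X \ Q₁ →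
        (∀ p ∈ X, -(2 * R₀) ≤ p 2 ∧ p 2 ≤ h + 2 * R₀ ∧ p 0 ^ 2 + p 1 ^ 2 ≤ ρ ^ 2) →
        (∀ p, p ∈ Q₁ ↔ (p ∈ (fun q => P₁ q + t₁) '' fccStacking 1 (Real.sqrt (2 / 3)) ∧
          -(2 * R₀) ≤ p 2 ∧ p 2 ≤ -R₀ ∧ p 0 ^ 2 + p 1 ^ 2 ≤ ρ ^ 2)) →
        (∀ p, p ∈ Q₂ ↔ (p ∈ (fun q => P₂ q + t₂) '' fccStacking 1 (Real.sqrt (2 / 3)) ∧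
          h + R₀ ≤ p 2 ∧ p 2 ≤ h + 2 * R₀ ∧ p 0 ^ 2 + p 1 ^ 2 ≤ ρ ^ 2)) →
        ((((Q₁ ×ˢ (X \ Q₁)).filter fun pq => dist pq.1 pq.2 = 1).card : ℕ) : ℝ) +
          ((((Q₂ ×ˢ ((X \ Q₁) \ Q₂)).filter fun pq => dist pq.1 pq.2 = 1).card : ℕ) : ℝ) ≤
          contactDeficiency ((X \ Q₁) \ Q₂) +
            (Real.sqrt 2 / 4 * ∑ᶠ w ∈ {w ∈ fccStacking 1 (Real.sqrt (2 / 3)) | ‖w‖ = 1},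
                |⟪w, P₁.symm (EuclideanSpace.single (2 : Fin 3) (1 : ℝ))⟫_ℝ| +
              Real.sqrt 2 / 4 * ∑ᶠ w ∈ {w ∈ fccStacking 1 (Real.sqrt (2 / 3)) | ‖w‖ = 1},
                |⟪w, P₂.symm (EuclideanSpace.single (2 : Fin 3) (1 : ℝ))⟫_ℝ| -
              (1 / 2 : ℝ) * Real.sqrt (1 - ⟪L (EuclideanSpace.single (2 : Fin 3) (1 : ℝ)),
                (EuclideanSpace.single (2 : Fin 3) (1 : ℝ))⟫_ℝ ^ 2)) * Real.pi * ρ ^ 2 +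
            C * (1 + h) * ρ

/-- **Debt F-U**: the uniform co-axial law FROM thickness `R` on, in lane T's `From` shape (`∀ R₀ ≥ R, ∃ C`). -/
def CoaxialTwoSlabAdhesionUnifFrom (R : ℝ) : Prop :=
  ∀ R₀ : ℝ, R ≤ R₀ → ∃ C : ℝ, CoaxialTwoSlabAdhesionUnifAt C R₀

/-- Sanity: the uniform law at some `R₀ ≥ 1` implies the registered per-pair stub `CoaxialTwoSlabAdhesion`. -/
theorem coaxialTwoSlabAdhesion_of_unifAt {C R₀ : ℝ} (hR₀ : 1 ≤ R₀) (h : CoaxialTwoSlabAdhesionUnifAt C R₀) :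
    CoaxialTwoSlabAdhesion := by
  intro A₁ t₁ A₂ t₂ hco hne
  obtain ⟨L, r₁, r₂, σ, σ', hσ, hσ', h₁, h₂, hcell⟩ := h A₁ t₁ A₂ t₂ hco hne
  exact ⟨L, r₁, r₂, σ, σ', hσ, hσ', h₁, h₂, C, R₀, hR₀, hcell⟩

/-- Hence `CoaxialTwoSlabAdhesionUnifFrom R` (any `R`) implies the registered stub. -/
theorem coaxialTwoSlabAdhesion_of_unifFrom {R : ℝ} (h : CoaxialTwoSlabAdhesionUnifFrom R) : CoaxialTwoSlabAdhesion := by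
  obtain ⟨C, hC⟩ := h (max R 1) (le_max_left _ _)
  exact coaxialTwoSlabAdhesion_of_unifAt (le_max_right _ _) hC

end Summit.Ventures.Crystal3D.Theorems

end
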